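import Summits.AtomisticToContinuum.HydrodynamicLimit.Theses.EnskogAdjointDuality
import Summits.AtomisticToContinuum.HydrodynamicLimit.Theorems.EnskogAdjointDualityDualityReductionEosWindow
import Summits.AtomisticToContinuum.HydrodynamicLimit.Theorems.TwoClocksEquilibriumFastWindowLDBirthT12Angular
import Literature.Analysis.UnboundedOperators.LinearizedBoltzmannFluxMoments
import Literature.Analysis.FunctionSpaces.PeriodicLogCost
import Summits.AtomisticToContinuum.HydrodynamicLimit.Theorems.EnskogAdjointDualityAdjointEnskogTestFamilyRHalfGaussian
import Summits.AtomisticToContinuum.HydrodynamicLimit.Theorems.EnskogAdjointDualityAdjointEnskogTestFamilyRFlight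
import Summits.AtomisticToContinuum.HydrodynamicLimit.Theorems.EnskogAdjointDualityAdjointEnskogTestFamilyRRadialSymmetry

/-!
# Refutation skeleton for crux `AdjointEnskogTestFamilyR` (stmt-AtomisticToContinuum-11592), line `refutation`

Route `EnskogAdjointDuality` of `AtomisticToContinuum/HydrodynamicLimit`, crux K2R
`Summit.AtomisticToContinuum.HydrodynamicLimit.Theses.EnskogAdjointDuality.AdjointEnskogTestFamilyR`.

The c4 lead showed on paper (Cruxes/AdjointEnskogTestFamilyR/HyperVelocityObstruction.md) that K2R is FALSE AS
TYPED (∀ v ∈ ℝ³): at fixed large `N` an isotropic cubic-in-`|v|` source of order `1/λ_N` (transport and Enskog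
delocalisation of the forced first corrector, second spatial difference of `γ`) meets the exactly critical
`ℓ = 0` sector of the test-side hard-sphere operator (`1+|v|²` is a collision invariant), so no admissible family
can keep `|κ^N| ≤ C(1+|v|²)` for all `v`.  This skeleton formalises the obstruction in the DUAL (weak–weak) form:
the defect inequality (iii) is tested against `Z(s,x)Θ(v)` for `Z = ζ(s)cos 2πx₀` / `ζ(s)sin 2πx₀` and the two
critical power weights `Θ₀^R(v) = (1+|v|²)⁻³e^{-|v|²/R}`, `Θ₁^R(v) = |v|(1+|v|²)⁻⁴e^{-|v|²/R} v₀`; the operator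
is moved onto the weights (pre/post-collisional duality per impact direction), where it becomes three EXPLICIT
kernels whose large-energy behaviour (stubs `kernelCritical`, `kernelDipole`, `kernelDeloc`) is 1-D real analysis;
the logarithm is `J_R = ∫ E²Θ₀^R ≍ log R → ∞` while every other term stays bounded in `R` at fixed `N`.
Witness data: EOS window `η₁` (`eos_window HsEosLowDensity_holds`), constant background `ρ ≡ η₁/(2σ³)`, `u ≡ 0`,
`θ ≡ 1` on `[0,2)`, `t = 1`, `χ = cos 2πx₀`, `a = b = 0`, `e = 1`.

Registered stubs (sorry ONLY there): `stub_halfGaussian`, `stub_sphereCalculus`, `stub_dualitySlice`,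
`stub_kernelCritical`, `stub_kernelDipole`, `stub_kernelDeloc`, `stub_flight` (κ-free analysis, wave 1) and
`stub_assembly` (the κ-dependent plumbing: flight identity, ψ-operator structure, Step A, the two tested
identities and the final `1/log R` bookkeeping — held by the lead, to be reshaped into smaller stubs as the
analytic layer lands).  Composition `not_AdjointEnskogTestFamilyR_of` (PROVED): the stubs give `¬ K2R` BY NAME.
-/

noncomputable section

namespace Summit.AtomisticToContinuum.HydrodynamicLimit.Cruxes.AdjointEnskogTestFamilyR.Refutation

open scoped BigOperators Topology InnerProductSpace Real
open Filter Set Function MeasureTheory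
open Summit.AtomisticToContinuum.HydrodynamicLimit.Theses.EnskogAdjointDuality (AdjointEnskogTestFamilyR)
open Literature.MathematicalPhysics.KineticTheory Literature.Analysis.FluidPDE Literature.Analysis.FunctionSpaces
open Literature.Analysis.UnboundedOperators (collisionFrequency)

/-! ### Stub statements (self-contained Props; every object is `let`-bound inside) -/

/-- **Half-Gaussian moments.** With `φ₁(b) = e^{-b²/2}/√(2π)` and `h(a) = ∫ (a-b)₊ φ₁(b) db`,
`P₂(a) = ∫ (a-b)₊² φ₁`, `P₃(a) = ∫ (a-b)₊(a²-b²) φ₁`: continuity, `0 ≤ h(a) - a₊ ≤ e^{-a²/2}`, `h(a) - h(-a) = a`,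
`0 ≤ P₂(a) ≤ 1 + a²`, `|P₃(a) - a₊³| ≤ 3(1+|a|)`; the 1-D marginal of the Maxwellian along a unit vector for these
three integrands; and the loss-rate asymptotics `π|v| ≤ ν(v) ≤ π|v| + 3π/(2|v|)`, `ν(v) ≤ π√(|v|²+3)`
(`ν = collisionFrequency`). -/
def HalfGaussian : Prop :=
  let φ₁ : ℝ → ℝ := fun b => Real.exp (-b ^ 2 / 2) / Real.sqrt (2 * Real.pi)
  let h : ℝ → ℝ := fun a => ∫ b, max (a - b) 0 * φ₁ b
  let P₂ : ℝ → ℝ := fun a => ∫ b, max (a - b) 0 ^ 2 * φ₁ b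
  let P₃ : ℝ → ℝ := fun a => ∫ b, max (a - b) 0 * (a ^ 2 - b ^ 2) * φ₁ b
  (Continuous h ∧ Continuous P₂ ∧ Continuous P₃) ∧
  (∀ a, 0 ≤ h a - max a 0 ∧ h a - max a 0 ≤ Real.exp (-a ^ 2 / 2) ∧ h a - h (-a) = a) ∧
  (∀ a, 0 ≤ P₂ a ∧ P₂ a ≤ 1 + a ^ 2) ∧
  (∀ a, |P₃ a - max a 0 ^ 3| ≤ 3 * (1 + |a|)) ∧
  (∀ (ω : Metric.sphere (0 : EuclideanSpace ℝ (Fin 3)) 1) (v : EuclideanSpace ℝ (Fin 3)),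
    (Integrable fun w : EuclideanSpace ℝ (Fin 3) =>
        max (inner ℝ (v - w) (ω : EuclideanSpace ℝ (Fin 3))) 0 * (1 + ‖w‖ ^ 2) * globalMaxwellian w) ∧
    (∫ w : EuclideanSpace ℝ (Fin 3), max (inner ℝ (v - w) (ω : EuclideanSpace ℝ (Fin 3))) 0 * globalMaxwellian w)
      = h (inner ℝ v (ω : EuclideanSpace ℝ (Fin 3))) ∧
    (∫ w : EuclideanSpace ℝ (Fin 3), max (inner ℝ (v - w) (ω : EuclideanSpace ℝ (Fin 3))) 0 *
        inner ℝ (v - w) (ω : EuclideanSpace ℝ (Fin 3)) * globalMaxwellian w)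
      = P₂ (inner ℝ v (ω : EuclideanSpace ℝ (Fin 3))) ∧
    (∫ w : EuclideanSpace ℝ (Fin 3), max (inner ℝ (v - w) (ω : EuclideanSpace ℝ (Fin 3))) 0 *
        (inner ℝ v (ω : EuclideanSpace ℝ (Fin 3)) ^ 2 - inner ℝ w (ω : EuclideanSpace ℝ (Fin 3)) ^ 2) *
          globalMaxwellian w)
      = P₃ (inner ℝ v (ω : EuclideanSpace ℝ (Fin 3)))) ∧
  (∀ v : EuclideanSpace ℝ (Fin 3),
    Real.pi * ‖v‖ ≤ collisionFrequency v ∧ collisionFrequency v ≤ Real.pi * Real.sqrt (‖v‖ ^ 2 + 3) ∧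
    (v ≠ 0 → |collisionFrequency v - Real.pi * ‖v‖| ≤ 3 * Real.pi / (2 * ‖v‖)))

/-- **Sphere calculus on `S² ⊆ ℝ³`** (`dσ = sphereMeasure`, mass `4π`): the degree-one Funk–Hecke formula
`∫ g(⟪a,ν⟫) ν dσ = (2π ∫_{-1}^{1} t g(t) dt) a` for unit `a`; the trigonometric constants of the delocalisation
`s_k = ∫ ν₀ sin(k ν₀) dσ`, `μ_k = ∫ (1 - cos(k ν₀)) dσ` with two-sided bounds for `0 ≤ k ≤ π/2`; the vanishing
odd/transverse integrals; and the radial moments of the critical weights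
`J_R = ∫₀^∞ E²(1+E)⁻³e^{-E/R} dE ≥ log R / 25`, `J'_R = ∫₀^∞ E³(1+E)⁻⁴e^{-E/R} dE`, `|J_R - J'_R| ≤ 4`,
`∫ (1+|v|²)⁻³e^{-|v|²/R}(v₀)₊³ dv = (π/4) J_R`, `∫ |v|(1+|v|²)⁻⁴e^{-|v|²/R}(v₀)₊⁴ dv = (π/5) J'_R`,
`∫ |v|(1+|v|²)⁻⁴e^{-|v|²/R} v₀²|v|² dv = (2π/3) J'_R`, plus the bounded moments used by the assembly. -/
def SphereCalculus : Prop :=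
  (∀ (a : EuclideanSpace ℝ (Fin 3)), ‖a‖ = 1 → ∀ g : ℝ → ℝ, ContinuousOn g (Set.Icc (-1) 1) →
    (∫ ν : Metric.sphere (0 : EuclideanSpace ℝ (Fin 3)) 1,
        g (inner ℝ a (ν : EuclideanSpace ℝ (Fin 3))) • (ν : EuclideanSpace ℝ (Fin 3)) ∂sphereMeasure)
      = (2 * Real.pi * ∫ t in (-1 : ℝ)..1, t * g t) • a) ∧
  (∀ k : ℝ, 0 ≤ k → k ≤ Real.pi / 2 →
    (∫ ν : Metric.sphere (0 : EuclideanSpace ℝ (Fin 3)) 1,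
        Real.sin (k * (ν : EuclideanSpace ℝ (Fin 3)) 0) ∂sphereMeasure) = 0 ∧
    (∫ ν : Metric.sphere (0 : EuclideanSpace ℝ (Fin 3)) 1,
        (ν : EuclideanSpace ℝ (Fin 3)) 0 * (Real.cos (k * (ν : EuclideanSpace ℝ (Fin 3)) 0) - 1) ∂sphereMeasure) = 0 ∧
    (∀ j : Fin 3, j ≠ 0 → ∀ g : ℝ → ℝ, ContinuousOn g (Set.Icc (-1) 1) →
      (∫ ν : Metric.sphere (0 : EuclideanSpace ℝ (Fin 3)) 1,
          (ν : EuclideanSpace ℝ (Fin 3)) j * g ((ν : EuclideanSpace ℝ (Fin 3)) 0) ∂sphereMeasure) = 0 ∧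
      (∫ ν : Metric.sphere (0 : EuclideanSpace ℝ (Fin 3)) 1,
          (ν : EuclideanSpace ℝ (Fin 3)) 0 * (ν : EuclideanSpace ℝ (Fin 3)) j *
            g ((ν : EuclideanSpace ℝ (Fin 3)) 0) ∂sphereMeasure) = 0) ∧
    8 * k / 3 ≤ (∫ ν : Metric.sphere (0 : EuclideanSpace ℝ (Fin 3)) 1,
        (ν : EuclideanSpace ℝ (Fin 3)) 0 * Real.sin (k * (ν : EuclideanSpace ℝ (Fin 3)) 0) ∂sphereMeasure) ∧
    (∫ ν : Metric.sphere (0 : EuclideanSpace ℝ (Fin 3)) 1,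
        (ν : EuclideanSpace ℝ (Fin 3)) 0 * Real.sin (k * (ν : EuclideanSpace ℝ (Fin 3)) 0) ∂sphereMeasure)
      ≤ 4 * Real.pi * k / 3 ∧
    k ^ 2 / 2 ≤ (∫ ν : Metric.sphere (0 : EuclideanSpace ℝ (Fin 3)) 1,
        (1 - Real.cos (k * (ν : EuclideanSpace ℝ (Fin 3)) 0)) ∂sphereMeasure) ∧
    (∫ ν : Metric.sphere (0 : EuclideanSpace ℝ (Fin 3)) 1,
        (1 - Real.cos (k * (ν : EuclideanSpace ℝ (Fin 3)) 0)) ∂sphereMeasure) ≤ 2 * Real.pi * k ^ 2 / 3 ∧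
    0 ≤ (∫ ν : Metric.sphere (0 : EuclideanSpace ℝ (Fin 3)) 1,
        (ν : EuclideanSpace ℝ (Fin 3)) 0 ^ 2 * (1 - Real.cos (k * (ν : EuclideanSpace ℝ (Fin 3)) 0)) ∂sphereMeasure) ∧
    (∫ ν : Metric.sphere (0 : EuclideanSpace ℝ (Fin 3)) 1,
        (ν : EuclideanSpace ℝ (Fin 3)) 0 ^ 2 * (1 - Real.cos (k * (ν : EuclideanSpace ℝ (Fin 3)) 0)) ∂sphereMeasure)
      ≤ 2 * Real.pi * k ^ 2 / 3) ∧
  (let th0 : ℝ → ℝ → ℝ := fun R E => ((1 + E) ^ 3)⁻¹ * Real.exp (-E / R)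
   let th1 : ℝ → ℝ → ℝ := fun R E => Real.sqrt E * ((1 + E) ^ 4)⁻¹ * Real.exp (-E / R)
   let J : ℝ → ℝ := fun R => ∫ E in Set.Ioi (0 : ℝ), E ^ 2 * th0 R E
   let J' : ℝ → ℝ := fun R => ∫ E in Set.Ioi (0 : ℝ), E ^ 3 * ((1 + E) ^ 4)⁻¹ * Real.exp (-E / R)
   ∀ R : ℝ, 1 ≤ R →
    (IntegrableOn (fun E => E ^ 2 * th0 R E) (Set.Ioi 0) ∧
     IntegrableOn (fun E => E ^ 3 * ((1 + E) ^ 4)⁻¹ * Real.exp (-E / R)) (Set.Ioi 0) ∧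
     Real.log R / 25 ≤ J R ∧ |J R - J' R| ≤ 4 ∧ 0 ≤ J' R) ∧
    (∀ k : ℕ, k ≤ 2 → Integrable (fun v : EuclideanSpace ℝ (Fin 3) => ‖v‖ ^ k * th0 R (‖v‖ ^ 2)) ∧
      ∫ v : EuclideanSpace ℝ (Fin 3), ‖v‖ ^ k * th0 R (‖v‖ ^ 2) ≤ 20) ∧
    (∀ k : ℕ, k ≤ 3 → Integrable (fun v : EuclideanSpace ℝ (Fin 3) => ‖v‖ ^ k * th1 R (‖v‖ ^ 2)) ∧
      ∫ v : EuclideanSpace ℝ (Fin 3), ‖v‖ ^ k * th1 R (‖v‖ ^ 2) ≤ 20) ∧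
    (Integrable (fun v : EuclideanSpace ℝ (Fin 3) => ‖v‖ ^ 3 * th0 R (‖v‖ ^ 2)) ∧
      ∫ v : EuclideanSpace ℝ (Fin 3), ‖v‖ ^ 3 * th0 R (‖v‖ ^ 2) = 2 * Real.pi * J R) ∧
    (Integrable (fun v : EuclideanSpace ℝ (Fin 3) => ‖v‖ ^ 4 * th1 R (‖v‖ ^ 2)) ∧
      ∫ v : EuclideanSpace ℝ (Fin 3), ‖v‖ ^ 4 * th1 R (‖v‖ ^ 2) = 2 * Real.pi * J' R) ∧
    (Integrable (fun v : EuclideanSpace ℝ (Fin 3) => th0 R (‖v‖ ^ 2) * max (v 0) 0 ^ 3) ∧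
      ∫ v : EuclideanSpace ℝ (Fin 3), th0 R (‖v‖ ^ 2) * max (v 0) 0 ^ 3 = Real.pi / 4 * J R) ∧
    (Integrable (fun v : EuclideanSpace ℝ (Fin 3) => th1 R (‖v‖ ^ 2) * max (v 0) 0 ^ 4) ∧
      ∫ v : EuclideanSpace ℝ (Fin 3), th1 R (‖v‖ ^ 2) * max (v 0) 0 ^ 4 = Real.pi / 5 * J' R) ∧
    (Integrable (fun v : EuclideanSpace ℝ (Fin 3) => th1 R (‖v‖ ^ 2) * (v 0) ^ 2 * ‖v‖ ^ 2) ∧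
      ∫ v : EuclideanSpace ℝ (Fin 3), th1 R (‖v‖ ^ 2) * (v 0) ^ 2 * ‖v‖ ^ 2 = 2 * Real.pi / 3 * J' R) ∧
    (Integrable (fun v : EuclideanSpace ℝ (Fin 3) => th1 R (‖v‖ ^ 2) * |v 0| * (1 + ‖v‖ ^ 2) ^ 4) ∧
      Integrable (fun v : EuclideanSpace ℝ (Fin 3) => th0 R (‖v‖ ^ 2) * (1 + ‖v‖ ^ 2) ^ 4)))

/-- **Pre/post-collisional duality per impact direction (the swap formula).** For a unit impact direction `ν`, a
weight `Θ` equal to the critical radial weight `Θ₀^R` or the dipole weight `Θ₁^R`, and a measurable `F` of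
quadratic growth: `∫ Θ(v) ∫ ((v-w)·ν)₊ M(w) F(w') dw dv = ∫ F(U) I[Θ](U,ν) dU`, `w' = (collide ν (v,w)).2`, with the
EXPLICIT kernels `I₀(U,ν) = ½ e^{-(|U|²-a²)/2} h(a) Θ̄₀(a²)`, `I₁(U,ν) = ν₀ a · ½ e^{-(|U|²-a²)/2} h(a) Θ̄₁(a²)`,
`a = ⟪U,ν⟫`, `Θ̄(x) = ∫_x^∞ ϑ` (frame `ν = e₃`: the collision swaps the third coordinates; `M = (2π)^{-3/2}e^{-|·|²/2}`),
together with the integrability of all integrands and the crude kernel bounds used downstream. -/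
def DualitySlice : Prop :=
  let φ₁ : ℝ → ℝ := fun b => Real.exp (-b ^ 2 / 2) / Real.sqrt (2 * Real.pi)
  let h : ℝ → ℝ := fun a => ∫ b, max (a - b) 0 * φ₁ b
  let th0 : ℝ → ℝ → ℝ := fun R E => ((1 + E) ^ 3)⁻¹ * Real.exp (-E / R)
  let th1 : ℝ → ℝ → ℝ := fun R E => Real.sqrt E * ((1 + E) ^ 4)⁻¹ * Real.exp (-E / R)
  let Tb0 : ℝ → ℝ → ℝ := fun R x => ∫ E in Set.Ioi x, th0 R E
  let Tb1 : ℝ → ℝ → ℝ := fun R x => ∫ E in Set.Ioi x, th1 R E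
  let I0 : ℝ → EuclideanSpace ℝ (Fin 3) → EuclideanSpace ℝ (Fin 3) → ℝ := fun R U n =>
    (1 / 2 : ℝ) * Real.exp (-(‖U‖ ^ 2 - inner ℝ U n ^ 2) / 2) * h (inner ℝ U n) * Tb0 R (inner ℝ U n ^ 2)
  let I1 : ℝ → EuclideanSpace ℝ (Fin 3) → EuclideanSpace ℝ (Fin 3) → ℝ := fun R U n =>
    n 0 * inner ℝ U n *
      ((1 / 2 : ℝ) * Real.exp (-(‖U‖ ^ 2 - inner ℝ U n ^ 2) / 2) * h (inner ℝ U n) * Tb1 R (inner ℝ U n ^ 2))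
  ∀ R : ℝ, 1 ≤ R → ∀ (ν : Metric.sphere (0 : EuclideanSpace ℝ (Fin 3)) 1)
    (F : EuclideanSpace ℝ (Fin 3) → ℝ), Measurable F → ∀ CF : ℝ, (∀ U, |F U| ≤ CF * (1 + ‖U‖ ^ 2)) →
    (Integrable (fun p : EuclideanSpace ℝ (Fin 3) × EuclideanSpace ℝ (Fin 3) =>
        th0 R (‖p.1‖ ^ 2) * (max (inner ℝ (p.1 - p.2) (ν : EuclideanSpace ℝ (Fin 3))) 0 * globalMaxwellian p.2 *
          F (collide ν p).2))) ∧
    (Integrable (fun U : EuclideanSpace ℝ (Fin 3) => F U * I0 R U ν)) ∧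
    (∫ v : EuclideanSpace ℝ (Fin 3), th0 R (‖v‖ ^ 2) * ∫ w : EuclideanSpace ℝ (Fin 3),
        max (inner ℝ (v - w) (ν : EuclideanSpace ℝ (Fin 3))) 0 * globalMaxwellian w * F (collide ν (v, w)).2)
      = ∫ U : EuclideanSpace ℝ (Fin 3), F U * I0 R U ν ∧
    (Integrable (fun p : EuclideanSpace ℝ (Fin 3) × EuclideanSpace ℝ (Fin 3) =>
        th1 R (‖p.1‖ ^ 2) * p.1 0 * (max (inner ℝ (p.1 - p.2) (ν : EuclideanSpace ℝ (Fin 3))) 0 *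
          globalMaxwellian p.2 * F (collide ν p).2))) ∧
    (Integrable (fun U : EuclideanSpace ℝ (Fin 3) => F U * I1 R U ν)) ∧
    (∫ v : EuclideanSpace ℝ (Fin 3), th1 R (‖v‖ ^ 2) * v 0 * ∫ w : EuclideanSpace ℝ (Fin 3),
        max (inner ℝ (v - w) (ν : EuclideanSpace ℝ (Fin 3))) 0 * globalMaxwellian w * F (collide ν (v, w)).2)
      = ∫ U : EuclideanSpace ℝ (Fin 3), F U * I1 R U ν ∧
    (∀ U, 0 ≤ I0 R U ν ∧ I0 R U ν ≤ (1 + |inner ℝ U ν|) * Real.exp (-(‖U‖ ^ 2 - inner ℝ U ν ^ 2) / 2) ∧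
      |I1 R U ν| ≤ (1 + |inner ℝ U ν|) ^ 2 * Real.exp (-(‖U‖ ^ 2 - inner ℝ U ν ^ 2) / 2))

/-- **Criticality of the `ℓ = 0` sector (K0).** For any `h` with `0 ≤ h(a) - a₊ ≤ e^{-a²/2}` and any loss profile
`n` with `πu ≤ n(u) ≤ π√(u²+3)`, the dual kernel of the critical weight `ϑ_R(E) = (1+E)⁻³e^{-E/R}`,
`k_R(E) = 2 g_R(E) - n(√E) ϑ_R(E)`, `g_R(E) = π ∫_{-1}^{1} e^{-E(1-t²)/2} h(√E t) Θ̄_R(E t²) dt`, has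
`∫₀^∞ (1+E) √E |k_R(E)| dE` bounded UNIFORMLY in `R ≥ 1` (gain `2π Θ̄/√E` cancels loss `π√E ϑ` exactly at the
power `3`: `2Θ̄_R - Eϑ_R = ϑ_R - R⁻¹∫_E^∞(1+x)⁻²e^{-x/R}`). -/
def KernelCritical : Prop :=
  let th0 : ℝ → ℝ → ℝ := fun R E => ((1 + E) ^ 3)⁻¹ * Real.exp (-E / R)
  let Tb0 : ℝ → ℝ → ℝ := fun R x => ∫ E in Set.Ioi x, th0 R E
  ∀ h : ℝ → ℝ, Continuous h → (∀ a, 0 ≤ h a - max a 0 ∧ h a - max a 0 ≤ Real.exp (-a ^ 2 / 2)) →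
  ∀ n : ℝ → ℝ, Measurable n → (∀ u, 0 ≤ u → Real.pi * u ≤ n u ∧ n u ≤ Real.pi * Real.sqrt (u ^ 2 + 3)) →
  ∃ M₀ : ℝ, ∀ R : ℝ, 1 ≤ R →
    let g : ℝ → ℝ := fun E => Real.pi * ∫ t in (-1 : ℝ)..1,
      Real.exp (-(E * (1 - t ^ 2)) / 2) * h (Real.sqrt E * t) * Tb0 R (E * t ^ 2)
    IntegrableOn (fun E => (1 + E) * Real.sqrt E * |2 * g E - n (Real.sqrt E) * th0 R E|) (Set.Ioi 0) ∧
    ∫ E in Set.Ioi (0 : ℝ), (1 + E) * Real.sqrt E * |2 * g E - n (Real.sqrt E) * th0 R E| ≤ M₀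

/-- **Contraction of the `ℓ = 1` sector (K1).** Same `h`, `n`; dipole weight `ϑ¹_R(E) = √E (1+E)⁻⁴ e^{-E/R}`,
`g¹_R(E) = π ∫_{-1}^{1} t² e^{-E(1-t²)/2} h(√E t) Θ̄¹_R(E t²) dt`: the kernel
`k¹_R(E) = 2g¹_R(E) - n(√E)ϑ¹_R(E)` equals `-(π/5) √E ϑ¹_R(E)` (the factor `2∫₀¹u^{3/2}du - 1 = -1/5`) up to an
error with `∫₀^∞ (1+E) E |·| dE` bounded uniformly in `R ≥ 1`. -/
def KernelDipole : Prop :=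
  let th1 : ℝ → ℝ → ℝ := fun R E => Real.sqrt E * ((1 + E) ^ 4)⁻¹ * Real.exp (-E / R)
  let Tb1 : ℝ → ℝ → ℝ := fun R x => ∫ E in Set.Ioi x, th1 R E
  ∀ h : ℝ → ℝ, Continuous h → (∀ a, 0 ≤ h a - max a 0 ∧ h a - max a 0 ≤ Real.exp (-a ^ 2 / 2)) →
  (∀ a, h a - h (-a) = a) →
  ∀ n : ℝ → ℝ, Measurable n → (∀ u, 0 ≤ u → Real.pi * u ≤ n u ∧ n u ≤ Real.pi * Real.sqrt (u ^ 2 + 3)) →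
  ∃ M₁ : ℝ, ∀ R : ℝ, 1 ≤ R →
    let g : ℝ → ℝ := fun E => Real.pi * ∫ t in (-1 : ℝ)..1,
      t ^ 2 * Real.exp (-(E * (1 - t ^ 2)) / 2) * h (Real.sqrt E * t) * Tb1 R (E * t ^ 2)
    IntegrableOn (fun E => (1 + E) * E *
      |2 * g E - n (Real.sqrt E) * th1 R E + Real.pi / 5 * Real.sqrt E * th1 R E|) (Set.Ioi 0) ∧
    ∫ E in Set.Ioi (0 : ℝ), (1 + E) * E *
      |2 * g E - n (Real.sqrt E) * th1 R E + Real.pi / 5 * Real.sqrt E * th1 R E| ≤ M₁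

/-- **First moment of the delocalised gain (K2).** Same `h`; for the critical weight the dipole moment of the
per-direction kernel, `g²_R(E) = π ∫_{-1}^{1} t e^{-E(1-t²)/2} h(√E t) Θ̄_R(E t²) dt`, equals `(π/2) √E ϑ_R(E)` up
to an error with `∫₀^∞ (1+E) E |g²_R(E)/√E - (π/2) ϑ_R(E)| dE` bounded uniformly in `R ≥ 1`. -/
def KernelDeloc : Prop :=
  let th0 : ℝ → ℝ → ℝ := fun R E => ((1 + E) ^ 3)⁻¹ * Real.exp (-E / R)
  let Tb0 : ℝ → ℝ → ℝ := fun R x => ∫ E in Set.Ioi x, th0 R E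
  ∀ h : ℝ → ℝ, Continuous h → (∀ a, 0 ≤ h a - max a 0 ∧ h a - max a 0 ≤ Real.exp (-a ^ 2 / 2)) →
  (∀ a, h a - h (-a) = a) →
  ∃ M₂ : ℝ, ∀ R : ℝ, 1 ≤ R →
    let g : ℝ → ℝ := fun E => Real.pi * ∫ t in (-1 : ℝ)..1,
      t * Real.exp (-(E * (1 - t ^ 2)) / 2) * h (Real.sqrt E * t) * Tb0 R (E * t ^ 2)
    IntegrableOn (fun E => (1 + E) * E * |g E / Real.sqrt E - Real.pi / 2 * th0 R E|) (Set.Ioi 0) ∧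
    ∫ E in Set.Ioi (0 : ℝ), (1 + E) * E * |g E / Real.sqrt E - Real.pi / 2 * th0 R E| ≤ M₂

/-- **Integration by parts along free flights, tested (the weak form of (ii)+(iii)).** For a jointly continuous
`Φ` of quadratic velocity growth that is `C¹` along every free flight of `𝕋³` on `[0,1]`, a jointly measurable `Ł`
of polynomial growth with `|∂_r Φ(r, x+(r-s)v, v)|_{r=s} + Ł(s,x,v)| ≤ η(1+|v|²)` on `[0,1] × 𝕋³ × ℝ³`, a test
function `Z(s,x) = ζ(s) ξ(x)` with `ζ` smooth and supported inside `(0,1)` and `ξ ∈ {cos 2πx₀, sin 2πx₀}`, and an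
integrable velocity weight `Θ` with `∫ |Θ|(1+|v|²)⁴ < ∞`:
`|∫₀¹∫∫ Θ(v) (-(∂_sZ + v·∇Z) Φ + Z Ł)| ≤ η ‖ζ‖_{L¹} ∫ |Θ|(1+|v|²)` (shear `x = y + sv` on the torus, Fubini, and
the one-dimensional integration by parts flight by flight; `D_sΦ` itself is never integrated). -/
def Flight : Prop :=
  ∀ (Φ Ł : ℝ → UnitAddTorus (Fin 3) → EuclideanSpace ℝ (Fin 3) → ℝ) (CΦ CL η : ℝ),
    Continuous (fun p : ℝ × UnitAddTorus (Fin 3) × EuclideanSpace ℝ (Fin 3) => Φ p.1 p.2.1 p.2.2) →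
    Measurable (fun p : ℝ × UnitAddTorus (Fin 3) × EuclideanSpace ℝ (Fin 3) => Ł p.1 p.2.1 p.2.2) →
    (∀ s x v, |Φ s x v| ≤ CΦ * (1 + ‖v‖ ^ 2)) →
    (∀ s ∈ Set.Icc (0 : ℝ) 1, ∀ x v, |Ł s x v| ≤ CL * (1 + ‖v‖ ^ 2) ^ 3) → 0 ≤ η →
    (∀ x v, ContDiffOn ℝ 1 (fun r => Φ r (x + Torus.proj (r • v)) v) (Set.Icc 0 1)) →
    (∀ s ∈ Set.Icc (0 : ℝ) 1, ∀ x v,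
      |derivWithin (fun r => Φ r (x + Torus.proj ((r - s) • v)) v) (Set.Icc 0 1) s + Ł s x v| ≤ η * (1 + ‖v‖ ^ 2)) →
    ∀ (ζ : ℝ → ℝ), ContDiff ℝ 1 ζ → (∀ s, s ≤ 0 ∨ 1 ≤ s → ζ s = 0) →
    ∀ (Θ : EuclideanSpace ℝ (Fin 3) → ℝ), Continuous Θ →
      Integrable (fun v => |Θ v| * (1 + ‖v‖ ^ 2) ^ 4) →
    ∀ trig : Bool,
    let ξ : UnitAddTorus (Fin 3) → ℝ := fun x => if trig then Torus.cosCoord 0 x else Torus.sinCoord 0 x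
    let ξ' : UnitAddTorus (Fin 3) → ℝ := fun x =>
      if trig then -(2 * Real.pi) * Torus.sinCoord 0 x else (2 * Real.pi) * Torus.cosCoord 0 x
    |∫ s in Set.Icc (0 : ℝ) 1, ∫ x : UnitAddTorus (Fin 3), ∫ v : EuclideanSpace ℝ (Fin 3),
        Θ v * (-(deriv ζ s * ξ x + ζ s * (v 0 * ξ' x)) * Φ s x v + ζ s * ξ x * Ł s x v)|
      ≤ η * (∫ s in Set.Icc (0 : ℝ) 1, |ζ s|) * ∫ v : EuclideanSpace ℝ (Fin 3), |Θ v| * (1 + ‖v‖ ^ 2)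

/-- **Radial symmetry integrals on `ℝ³`** (sub-goal of the assembly). For a continuous radial
profile `ϑ` with `∫ |ϑ(|v|²)|(1+|v|²)³ < ∞` and a continuous `P` of cubic growth: the odd moments vanish
(`∫ ϑ v_j = ∫ ϑ v_j|v|² = ∫ ϑ v₀³ = 0`, `∫ ϑ v_i v_j = 0` and `∫ ϑ v₀² v_j = 0` for `i ≠ j`, `∫ ϑ v_j P(v₀) = 0`
for `j ≠ 0`), `∫ ϑ v_j² = ⅓∫ ϑ |v|²`, and a unit vector `ω` can be rotated to `e₀`:
`∫ ϑ(|v|²) P(⟪v,ω⟫) dv = ∫ ϑ(|v|²) P(v₀) dv`, `∫ ϑ(|v|²) v₀ P(⟪v,ω⟫) dv = ω₀ ∫ ϑ(|v|²) v₀ P(v₀) dv`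
(coordinate reflections / a rotation `e₀ ↦ ω` are linear isometries, hence volume preserving). -/
def RadialSymmetry : Prop :=
  ∀ (ϑ P : ℝ → ℝ) (CP : ℝ), Continuous ϑ → Continuous P → (∀ a, |P a| ≤ CP * (1 + |a|) ^ 3) →
    Integrable (fun v : EuclideanSpace ℝ (Fin 3) => |ϑ (‖v‖ ^ 2)| * (1 + ‖v‖ ^ 2) ^ 3) →
    (∀ j : Fin 3, Integrable (fun v : EuclideanSpace ℝ (Fin 3) => ϑ (‖v‖ ^ 2) * v j * ‖v‖ ^ 2) ∧
      ∫ v : EuclideanSpace ℝ (Fin 3), ϑ (‖v‖ ^ 2) * v j = 0 ∧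
      ∫ v : EuclideanSpace ℝ (Fin 3), ϑ (‖v‖ ^ 2) * v j * ‖v‖ ^ 2 = 0 ∧
      ∫ v : EuclideanSpace ℝ (Fin 3), ϑ (‖v‖ ^ 2) * v j ^ 2 =
        (1 / 3 : ℝ) * ∫ v : EuclideanSpace ℝ (Fin 3), ϑ (‖v‖ ^ 2) * ‖v‖ ^ 2) ∧
    (∀ i j : Fin 3, i ≠ j → Integrable (fun v : EuclideanSpace ℝ (Fin 3) => ϑ (‖v‖ ^ 2) * v i * v j) ∧
      ∫ v : EuclideanSpace ℝ (Fin 3), ϑ (‖v‖ ^ 2) * v i * v j = 0 ∧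
      ∫ v : EuclideanSpace ℝ (Fin 3), ϑ (‖v‖ ^ 2) * v i ^ 2 * v j = 0) ∧
    (∫ v : EuclideanSpace ℝ (Fin 3), ϑ (‖v‖ ^ 2) * v 0 ^ 3 = 0) ∧
    (∀ (ω : Metric.sphere (0 : EuclideanSpace ℝ (Fin 3)) 1),
      Integrable (fun v : EuclideanSpace ℝ (Fin 3) =>
        ϑ (‖v‖ ^ 2) * P (inner ℝ v (ω : EuclideanSpace ℝ (Fin 3)))) ∧
      Integrable (fun v : EuclideanSpace ℝ (Fin 3) =>
        ϑ (‖v‖ ^ 2) * v 0 * P (inner ℝ v (ω : EuclideanSpace ℝ (Fin 3)))) ∧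
      (∫ v : EuclideanSpace ℝ (Fin 3), ϑ (‖v‖ ^ 2) * P (inner ℝ v (ω : EuclideanSpace ℝ (Fin 3)))) =
        ∫ v : EuclideanSpace ℝ (Fin 3), ϑ (‖v‖ ^ 2) * P (v 0) ∧
      (∫ v : EuclideanSpace ℝ (Fin 3), ϑ (‖v‖ ^ 2) * v 0 * P (inner ℝ v (ω : EuclideanSpace ℝ (Fin 3)))) =
        (ω : EuclideanSpace ℝ (Fin 3)) 0 * ∫ v : EuclideanSpace ℝ (Fin 3), ϑ (‖v‖ ^ 2) * v 0 * P (v 0) ∧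
      (∀ j : Fin 3, j ≠ 0 → ∫ v : EuclideanSpace ℝ (Fin 3), ϑ (‖v‖ ^ 2) * v j * P (v 0) = 0))

/-- **Bridge from the explicit 3-D kernels to the 1-D profiles of K0/K1/K2** (sub-goal of the assembly).
With `I₀, I₁` the swap kernels of `DualitySlice` and `g⁰, g¹, g²` the profiles of `KernelCritical`,
`KernelDipole`, `KernelDeloc`: `∫ I₀(U,ν) dσ(ν) = g⁰(|U|²)` (hat-box), `∫ I₀(U,ν) ν dσ = (g²(|U|²)/|U|) U` and
`∫ I₁(U,ν) dσ = U₀ g¹(|U|²)` (degree-one Funk–Hecke, taken as a hypothesis in the form proved by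
`stub_sphereCalculus`), and the polar reductions `∫ (1+|U|²)|k(|U|²)| dU = 2π∫₀^∞(1+E)√E|k|`,
`∫ |U₀|(1+|U|²)|k(|U|²)| dU = π∫₀^∞(1+E)E|k|`. -/
def KernelBridge : Prop :=
  let φ₁ : ℝ → ℝ := fun b => Real.exp (-b ^ 2 / 2) / Real.sqrt (2 * Real.pi)
  let h : ℝ → ℝ := fun a => ∫ b, max (a - b) 0 * φ₁ b
  let th0 : ℝ → ℝ → ℝ := fun R E => ((1 + E) ^ 3)⁻¹ * Real.exp (-E / R)
  let th1 : ℝ → ℝ → ℝ := fun R E => Real.sqrt E * ((1 + E) ^ 4)⁻¹ * Real.exp (-E / R)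
  let Tb0 : ℝ → ℝ → ℝ := fun R x => ∫ E in Set.Ioi x, th0 R E
  let Tb1 : ℝ → ℝ → ℝ := fun R x => ∫ E in Set.Ioi x, th1 R E
  let I0 : ℝ → EuclideanSpace ℝ (Fin 3) → EuclideanSpace ℝ (Fin 3) → ℝ := fun R U n =>
    (1 / 2 : ℝ) * Real.exp (-(‖U‖ ^ 2 - inner ℝ U n ^ 2) / 2) * h (inner ℝ U n) * Tb0 R (inner ℝ U n ^ 2)
  let I1 : ℝ → EuclideanSpace ℝ (Fin 3) → EuclideanSpace ℝ (Fin 3) → ℝ := fun R U n =>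
    n 0 * inner ℝ U n *
      ((1 / 2 : ℝ) * Real.exp (-(‖U‖ ^ 2 - inner ℝ U n ^ 2) / 2) * h (inner ℝ U n) * Tb1 R (inner ℝ U n ^ 2))
  let g0 : ℝ → ℝ → ℝ := fun R E => Real.pi * ∫ t in (-1 : ℝ)..1,
    Real.exp (-(E * (1 - t ^ 2)) / 2) * h (Real.sqrt E * t) * Tb0 R (E * t ^ 2)
  let g1 : ℝ → ℝ → ℝ := fun R E => Real.pi * ∫ t in (-1 : ℝ)..1,
    t ^ 2 * Real.exp (-(E * (1 - t ^ 2)) / 2) * h (Real.sqrt E * t) * Tb1 R (E * t ^ 2)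
  let g2 : ℝ → ℝ → ℝ := fun R E => Real.pi * ∫ t in (-1 : ℝ)..1,
    t * Real.exp (-(E * (1 - t ^ 2)) / 2) * h (Real.sqrt E * t) * Tb0 R (E * t ^ 2)
  (∀ (a : EuclideanSpace ℝ (Fin 3)), ‖a‖ = 1 → ∀ g : ℝ → ℝ, ContinuousOn g (Set.Icc (-1) 1) →
    (∫ ν : Metric.sphere (0 : EuclideanSpace ℝ (Fin 3)) 1,
        g (inner ℝ a (ν : EuclideanSpace ℝ (Fin 3))) • (ν : EuclideanSpace ℝ (Fin 3)) ∂sphereMeasure)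
      = (2 * Real.pi * ∫ t in (-1 : ℝ)..1, t * g t) • a) →
  ∀ R : ℝ, 1 ≤ R →
    (∀ U : EuclideanSpace ℝ (Fin 3),
      Integrable (fun ν : Metric.sphere (0 : EuclideanSpace ℝ (Fin 3)) 1 => I0 R U ν) sphereMeasure ∧
      Integrable (fun ν : Metric.sphere (0 : EuclideanSpace ℝ (Fin 3)) 1 => I1 R U ν) sphereMeasure ∧
      (∫ ν : Metric.sphere (0 : EuclideanSpace ℝ (Fin 3)) 1, I0 R U ν ∂sphereMeasure) = g0 R (‖U‖ ^ 2) ∧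
      (∫ ν : Metric.sphere (0 : EuclideanSpace ℝ (Fin 3)) 1,
          I0 R U ν • (ν : EuclideanSpace ℝ (Fin 3)) ∂sphereMeasure) = (g2 R (‖U‖ ^ 2) / ‖U‖) • U ∧
      (∫ ν : Metric.sphere (0 : EuclideanSpace ℝ (Fin 3)) 1, I1 R U ν ∂sphereMeasure) = U 0 * g1 R (‖U‖ ^ 2)) ∧
    (∀ k : ℝ → ℝ, Measurable k →
      IntegrableOn (fun E => (1 + E) * Real.sqrt E * |k E|) (Set.Ioi 0) →
      Integrable (fun U : EuclideanSpace ℝ (Fin 3) => (1 + ‖U‖ ^ 2) * |k (‖U‖ ^ 2)|) ∧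
      ∫ U : EuclideanSpace ℝ (Fin 3), (1 + ‖U‖ ^ 2) * |k (‖U‖ ^ 2)| =
        2 * Real.pi * ∫ E in Set.Ioi (0 : ℝ), (1 + E) * Real.sqrt E * |k E|) ∧
    (∀ k : ℝ → ℝ, Measurable k →
      IntegrableOn (fun E => (1 + E) * E * |k E|) (Set.Ioi 0) →
      Integrable (fun U : EuclideanSpace ℝ (Fin 3) => |U 0| * (1 + ‖U‖ ^ 2) * |k (‖U‖ ^ 2)|) ∧
      ∫ U : EuclideanSpace ℝ (Fin 3), |U 0| * (1 + ‖U‖ ^ 2) * |k (‖U‖ ^ 2)| =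
        Real.pi * ∫ E in Set.Ioi (0 : ℝ), (1 + E) * E * |k E|)

/-- **The test-side operator on the corrector `κ`, split into its four pieces** (sub-goal of the
assembly). For a continuous `g₁ : ℝ³ → ℝ` (the local test function `κ(x,·)`) and a continuous
`g₂ : S² × ℝ³ → ℝ` (the partner's `κ(x + εω, ·)`), both of quadratic growth, and the Maxwellian weight
`q₊ Y₀ (ρ₀ M(w))`, `q = ⟪v−w,ω⟫`: the bracket integral splits as
`Y₀ρ₀ (∫∫ q₊M g₁(w') + ∫∫ q₊M g₂(ω,w') − ν(v) g₁(v) − ∫∫ q₊M g₂(ω,w))` — the local gain written on the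
STRUCK particle by the three-dimensional gain-exchange symmetry `∫ q₊ ψ(v') dσ = ∫ q₊ ψ(w') dσ`
(`gainFst_eq_gainSnd`), the loss through `ν = collisionFrequency` — with the integrability of every piece on
`sphereMeasure ⊗ volume` and the exchange-piece bound `∫∫ q₊ M (1+|w|²) ≤ 4π(4|v| + 9)`. -/
def KappaOperator : Prop :=
  ∀ (Y₀ ρ₀ C : ℝ) (g₁ : EuclideanSpace ℝ (Fin 3) → ℝ)
    (g₂ : Metric.sphere (0 : EuclideanSpace ℝ (Fin 3)) 1 × EuclideanSpace ℝ (Fin 3) → ℝ),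
    Continuous g₁ → Continuous g₂ → (∀ u, |g₁ u| ≤ C * (1 + ‖u‖ ^ 2)) → (∀ ω u, |g₂ (ω, u)| ≤ C * (1 + ‖u‖ ^ 2)) →
    ∀ v : EuclideanSpace ℝ (Fin 3),
    (Integrable (fun p : Metric.sphere (0 : EuclideanSpace ℝ (Fin 3)) 1 × EuclideanSpace ℝ (Fin 3) =>
        max (inner ℝ (v - p.2) (p.1 : EuclideanSpace ℝ (Fin 3))) 0 * globalMaxwellian p.2 *
          g₁ (p.2 + inner ℝ (v - p.2) (p.1 : EuclideanSpace ℝ (Fin 3)) • (p.1 : EuclideanSpace ℝ (Fin 3))))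
        ((sphereMeasure : Measure (Metric.sphere (0 : EuclideanSpace ℝ (Fin 3)) 1)).prod volume)) ∧
    (Integrable (fun p : Metric.sphere (0 : EuclideanSpace ℝ (Fin 3)) 1 × EuclideanSpace ℝ (Fin 3) =>
        max (inner ℝ (v - p.2) (p.1 : EuclideanSpace ℝ (Fin 3))) 0 * globalMaxwellian p.2 *
          g₂ (p.1, p.2 + inner ℝ (v - p.2) (p.1 : EuclideanSpace ℝ (Fin 3)) • (p.1 : EuclideanSpace ℝ (Fin 3))))
        ((sphereMeasure : Measure (Metric.sphere (0 : EuclideanSpace ℝ (Fin 3)) 1)).prod volume)) ∧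
    (Integrable (fun p : Metric.sphere (0 : EuclideanSpace ℝ (Fin 3)) 1 × EuclideanSpace ℝ (Fin 3) =>
        max (inner ℝ (v - p.2) (p.1 : EuclideanSpace ℝ (Fin 3))) 0 * globalMaxwellian p.2 * g₂ (p.1, p.2))
        ((sphereMeasure : Measure (Metric.sphere (0 : EuclideanSpace ℝ (Fin 3)) 1)).prod volume)) ∧
    (Integrable (fun p : Metric.sphere (0 : EuclideanSpace ℝ (Fin 3)) 1 × EuclideanSpace ℝ (Fin 3) =>
        max (inner ℝ (v - p.2) (p.1 : EuclideanSpace ℝ (Fin 3))) 0 * globalMaxwellian p.2 * (1 + ‖p.2‖ ^ 2))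
        ((sphereMeasure : Measure (Metric.sphere (0 : EuclideanSpace ℝ (Fin 3)) 1)).prod volume)) ∧
    (∫ p : Metric.sphere (0 : EuclideanSpace ℝ (Fin 3)) 1 × EuclideanSpace ℝ (Fin 3),
        max (inner ℝ (v - p.2) (p.1 : EuclideanSpace ℝ (Fin 3))) 0 * globalMaxwellian p.2 * (1 + ‖p.2‖ ^ 2)
        ∂((sphereMeasure : Measure (Metric.sphere (0 : EuclideanSpace ℝ (Fin 3)) 1)).prod volume)
      ≤ 4 * Real.pi * (4 * ‖v‖ + 9)) ∧
    (∫ ω : Metric.sphere (0 : EuclideanSpace ℝ (Fin 3)) 1, (∫ w : EuclideanSpace ℝ (Fin 3),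
        max (inner ℝ (v - w) (ω : EuclideanSpace ℝ (Fin 3))) 0 * Y₀ * (ρ₀ * globalMaxwellian w) *
          (g₁ (v - inner ℝ (v - w) (ω : EuclideanSpace ℝ (Fin 3)) • (ω : EuclideanSpace ℝ (Fin 3))) +
            g₂ (ω, w + inner ℝ (v - w) (ω : EuclideanSpace ℝ (Fin 3)) • (ω : EuclideanSpace ℝ (Fin 3))) -
            g₁ v - g₂ (ω, w))) ∂sphereMeasure) =
      Y₀ * ρ₀ * ((∫ p : Metric.sphere (0 : EuclideanSpace ℝ (Fin 3)) 1 × EuclideanSpace ℝ (Fin 3),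
          max (inner ℝ (v - p.2) (p.1 : EuclideanSpace ℝ (Fin 3))) 0 * globalMaxwellian p.2 *
            g₁ (p.2 + inner ℝ (v - p.2) (p.1 : EuclideanSpace ℝ (Fin 3)) • (p.1 : EuclideanSpace ℝ (Fin 3)))
          ∂((sphereMeasure : Measure (Metric.sphere (0 : EuclideanSpace ℝ (Fin 3)) 1)).prod volume)) +
        (∫ p : Metric.sphere (0 : EuclideanSpace ℝ (Fin 3)) 1 × EuclideanSpace ℝ (Fin 3),
          max (inner ℝ (v - p.2) (p.1 : EuclideanSpace ℝ (Fin 3))) 0 * globalMaxwellian p.2 *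
            g₂ (p.1, p.2 + inner ℝ (v - p.2) (p.1 : EuclideanSpace ℝ (Fin 3)) • (p.1 : EuclideanSpace ℝ (Fin 3)))
          ∂((sphereMeasure : Measure (Metric.sphere (0 : EuclideanSpace ℝ (Fin 3)) 1)).prod volume)) -
        collisionFrequency v * g₁ v -
        (∫ p : Metric.sphere (0 : EuclideanSpace ℝ (Fin 3)) 1 × EuclideanSpace ℝ (Fin 3),
          max (inner ℝ (v - p.2) (p.1 : EuclideanSpace ℝ (Fin 3))) 0 * globalMaxwellian p.2 * g₂ (p.1, p.2)
          ∂((sphereMeasure : Measure (Metric.sphere (0 : EuclideanSpace ℝ (Fin 3)) 1)).prod volume)))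

/-- **Identity (0), ψ-part** (sub-goal of the assembly; wave 3). Tested against
`z·cos(2πx₀)` / transport coefficient `-(z' cos(2πx₀) + z v₀ (-2π sin(2πx₀)))` and the critical weight
`(1+|v|²)⁻³e^{-|v|²/R}`, the hydrodynamic part `ψ = α + β·v + γ|v|²/2` and the operator `Lψ` on it contribute
`-z (π/8) λ Y₀ρ₀ μ_ε J_R ∫cos(2πx₀)γ` (second spatial difference of `γ`: `∫_{S²}(cos(2πεν₀) - 1)dσ = -μ_ε`,
`∫ ϑ P₃(v₀) dv = (π/4)J_R + O(1)`) plus terms bounded uniformly in `R ≥ 1` and in the data (through `C` only). -/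
def PsiZero : Prop :=
  ∀ (Y₀ ρ₀ ε lam C : ℝ), 0 < Y₀ → 0 < ρ₀ → 0 < ε → 2 * Real.pi * ε ≤ Real.pi / 2 → 0 < lam → 0 ≤ C →
  ∃ Bdd : ℝ, ∀ (cc : UnitAddTorus (Fin 3) → ℝ × EuclideanSpace ℝ (Fin 3) × ℝ) (κ : UnitAddTorus (Fin 3) → EuclideanSpace ℝ (Fin 3) → ℝ),
    Continuous cc → Continuous (Function.uncurry κ) → (∀ x, ‖cc x‖ ≤ C) →
    (∀ x y, dist (cc x) (cc y) ≤ C * dist x y) → (∀ x v, |κ x v| ≤ C * (1 + ‖v‖ ^ 2)) →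
    ∀ (Lψ : UnitAddTorus (Fin 3) → EuclideanSpace ℝ (Fin 3) → ℝ), (∀ x v, Lψ x v = lam * ∫ ω : Metric.sphere (0 : EuclideanSpace ℝ (Fin 3)) 1, (∫ w : EuclideanSpace ℝ (Fin 3),
        max (inner ℝ (v - w) (ω : EuclideanSpace ℝ (Fin 3))) 0 * Y₀ * (ρ₀ * globalMaxwellian w) *
          (((cc x).1 + inner ℝ (cc x).2.1 (v - inner ℝ (v - w) (ω : EuclideanSpace ℝ (Fin 3)) • (ω : EuclideanSpace ℝ (Fin 3))) + (cc x).2.2 * ‖(v - inner ℝ (v - w) (ω : EuclideanSpace ℝ (Fin 3)) • (ω : EuclideanSpace ℝ (Fin 3)))‖ ^ 2 / 2) +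
            ((cc (x + Torus.proj (ε • (ω : EuclideanSpace ℝ (Fin 3))))).1 + inner ℝ (cc (x + Torus.proj (ε • (ω : EuclideanSpace ℝ (Fin 3))))).2.1 (w + inner ℝ (v - w) (ω : EuclideanSpace ℝ (Fin 3)) • (ω : EuclideanSpace ℝ (Fin 3))) + (cc (x + Torus.proj (ε • (ω : EuclideanSpace ℝ (Fin 3))))).2.2 * ‖(w + inner ℝ (v - w) (ω : EuclideanSpace ℝ (Fin 3)) • (ω : EuclideanSpace ℝ (Fin 3)))‖ ^ 2 / 2) -
            ((cc x).1 + inner ℝ (cc x).2.1 v + (cc x).2.2 * ‖v‖ ^ 2 / 2) -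
            ((cc (x + Torus.proj (ε • (ω : EuclideanSpace ℝ (Fin 3))))).1 + inner ℝ (cc (x + Torus.proj (ε • (ω : EuclideanSpace ℝ (Fin 3))))).2.1 w + (cc (x + Torus.proj (ε • (ω : EuclideanSpace ℝ (Fin 3))))).2.2 * ‖w‖ ^ 2 / 2))) ∂sphereMeasure) →
    ∀ R : ℝ, 1 ≤ R → ∀ z z' : ℝ,
    Integrable (fun p : UnitAddTorus (Fin 3) × EuclideanSpace ℝ (Fin 3) => ((1 + ‖p.2‖ ^ 2) ^ 3)⁻¹ * Real.exp (-‖p.2‖ ^ 2 / R) * ((-(z' * Torus.cosCoord 0 p.1 + z * (p.2 0 * (-(2 * Real.pi) * Torus.sinCoord 0 p.1)))) * ((cc p.1).1 + inner ℝ (cc p.1).2.1 p.2 + (cc p.1).2.2 * ‖p.2‖ ^ 2 / 2) + (z * Torus.cosCoord 0 p.1) * Lψ p.1 p.2)) (volume.prod volume) ∧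
    |(∫ x : UnitAddTorus (Fin 3), ∫ v : EuclideanSpace ℝ (Fin 3), ((1 + ‖v‖ ^ 2) ^ 3)⁻¹ * Real.exp (-‖v‖ ^ 2 / R) * ((-(z' * Torus.cosCoord 0 x + z * (v 0 * (-(2 * Real.pi) * Torus.sinCoord 0 x)))) * ((cc x).1 + inner ℝ (cc x).2.1 v + (cc x).2.2 * ‖v‖ ^ 2 / 2) + (z * Torus.cosCoord 0 x) * Lψ x v)) -
        (-(z * (Real.pi / 8) * lam * (Y₀ * ρ₀) * (∫ ν : Metric.sphere (0 : EuclideanSpace ℝ (Fin 3)) 1, (1 - Real.cos (2 * Real.pi * ε * (ν : EuclideanSpace ℝ (Fin 3)) 0)) ∂sphereMeasure) *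
          (∫ E in Set.Ioi (0 : ℝ), E ^ 2 * (((1 + E) ^ 3)⁻¹ * Real.exp (-E / R))) * (∫ x : UnitAddTorus (Fin 3), Torus.cosCoord 0 x * (cc x).2.2)))| ≤ (|z| + |z'|) * Bdd

/-- **Identity (0), transport of `κ`** (sub-goal of the assembly; wave 3): the coefficient
`-(z' cos + z v₀(-2π sin))` against `λ⁻¹κ` and the critical weight gives `z (2π/λ) 𝔨₀` — the first-moment
functional `𝔨₀ = ∫∫ ϑ v₀ sin(2πx₀) κ` — plus `|z'| λ⁻¹ C (m₀ + m₂)`. -/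
def TransportKappaZero : Prop :=
  ∀ (Y₀ ρ₀ ε lam C : ℝ), 0 < Y₀ → 0 < ρ₀ → 0 < ε → 2 * Real.pi * ε ≤ Real.pi / 2 → 0 < lam → 0 ≤ C →
  ∃ Bdd : ℝ, ∀ (cc : UnitAddTorus (Fin 3) → ℝ × EuclideanSpace ℝ (Fin 3) × ℝ) (κ : UnitAddTorus (Fin 3) → EuclideanSpace ℝ (Fin 3) → ℝ),
    Continuous cc → Continuous (Function.uncurry κ) → (∀ x, ‖cc x‖ ≤ C) →
    (∀ x y, dist (cc x) (cc y) ≤ C * dist x y) → (∀ x v, |κ x v| ≤ C * (1 + ‖v‖ ^ 2)) →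
    ∀ R : ℝ, 1 ≤ R → ∀ z z' : ℝ,
    Integrable (fun p : UnitAddTorus (Fin 3) × EuclideanSpace ℝ (Fin 3) => ((1 + ‖p.2‖ ^ 2) ^ 3)⁻¹ * Real.exp (-‖p.2‖ ^ 2 / R) * ((-(z' * Torus.cosCoord 0 p.1 + z * (p.2 0 * (-(2 * Real.pi) * Torus.sinCoord 0 p.1)))) * (lam⁻¹ * κ p.1 p.2))) (volume.prod volume) ∧
    |(∫ x : UnitAddTorus (Fin 3), ∫ v : EuclideanSpace ℝ (Fin 3), ((1 + ‖v‖ ^ 2) ^ 3)⁻¹ * Real.exp (-‖v‖ ^ 2 / R) * ((-(z' * Torus.cosCoord 0 x + z * (v 0 * (-(2 * Real.pi) * Torus.sinCoord 0 x)))) * (lam⁻¹ * κ x v))) -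
        z * (2 * Real.pi / lam) * (∫ x : UnitAddTorus (Fin 3), ∫ v : EuclideanSpace ℝ (Fin 3), ((1 + ‖v‖ ^ 2) ^ 3)⁻¹ * Real.exp (-‖v‖ ^ 2 / R) * v 0 * Torus.sinCoord 0 x * κ x v)| ≤ (|z| + |z'|) * Bdd

/-- **Identity (0), operator on `κ`** (sub-goal of the assembly; wave 3): tested against `z cos(2πx₀)` and
the critical weight, the bracket `Lκ` gives `z π² ε Y₀ρ₀ 𝔨₀` (delocalised gain, first moment of the dual
kernel `= (π/2)ϑ U` by K2) plus a part bounded uniformly in `R` (criticality K0, exchange piece) plus the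
un-pinned second-order delocalisation `≤ |z| Y₀ρ₀ C 32π² (k²/2 + k³/6) J_R`, `k = 2πε`. -/
def OperatorKappaZero : Prop :=
  ∀ (Y₀ ρ₀ ε lam C : ℝ), 0 < Y₀ → 0 < ρ₀ → 0 < ε → 2 * Real.pi * ε ≤ Real.pi / 2 → 0 < lam → 0 ≤ C →
  ∃ Bdd : ℝ, ∀ (cc : UnitAddTorus (Fin 3) → ℝ × EuclideanSpace ℝ (Fin 3) × ℝ) (κ : UnitAddTorus (Fin 3) → EuclideanSpace ℝ (Fin 3) → ℝ),
    Continuous cc → Continuous (Function.uncurry κ) → (∀ x, ‖cc x‖ ≤ C) →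
    (∀ x y, dist (cc x) (cc y) ≤ C * dist x y) → (∀ x v, |κ x v| ≤ C * (1 + ‖v‖ ^ 2)) →
    ∀ (Lκ : UnitAddTorus (Fin 3) → EuclideanSpace ℝ (Fin 3) → ℝ), (∀ x v, Lκ x v = ∫ ω : Metric.sphere (0 : EuclideanSpace ℝ (Fin 3)) 1, (∫ w : EuclideanSpace ℝ (Fin 3),
        max (inner ℝ (v - w) (ω : EuclideanSpace ℝ (Fin 3))) 0 * Y₀ * (ρ₀ * globalMaxwellian w) *
          (κ x (v - inner ℝ (v - w) (ω : EuclideanSpace ℝ (Fin 3)) • (ω : EuclideanSpace ℝ (Fin 3))) + κ (x + Torus.proj (ε • (ω : EuclideanSpace ℝ (Fin 3)))) (w + inner ℝ (v - w) (ω : EuclideanSpace ℝ (Fin 3)) • (ω : EuclideanSpace ℝ (Fin 3))) - κ x v - κ (x + Torus.proj (ε • (ω : EuclideanSpace ℝ (Fin 3)))) w)) ∂sphereMeasure) →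
    ∀ R : ℝ, 1 ≤ R → ∀ z z' : ℝ,
    Integrable (fun p : UnitAddTorus (Fin 3) × EuclideanSpace ℝ (Fin 3) => ((1 + ‖p.2‖ ^ 2) ^ 3)⁻¹ * Real.exp (-‖p.2‖ ^ 2 / R) * ((z * Torus.cosCoord 0 p.1) * Lκ p.1 p.2)) (volume.prod volume) ∧
    |(∫ x : UnitAddTorus (Fin 3), ∫ v : EuclideanSpace ℝ (Fin 3), ((1 + ‖v‖ ^ 2) ^ 3)⁻¹ * Real.exp (-‖v‖ ^ 2 / R) * ((z * Torus.cosCoord 0 x) * Lκ x v)) -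
        z * (Real.pi ^ 2 * ε * (Y₀ * ρ₀)) * (∫ x : UnitAddTorus (Fin 3), ∫ v : EuclideanSpace ℝ (Fin 3), ((1 + ‖v‖ ^ 2) ^ 3)⁻¹ * Real.exp (-‖v‖ ^ 2 / R) * v 0 * Torus.sinCoord 0 x * κ x v)| ≤
      (|z| + |z'|) * (Bdd + Y₀ * ρ₀ * C * (32 * Real.pi ^ 2) *
        ((2 * Real.pi * ε) ^ 2 / 2 + (2 * Real.pi * ε) ^ 3 / 6) * (∫ E in Set.Ioi (0 : ℝ), E ^ 2 * (((1 + E) ^ 3)⁻¹ * Real.exp (-E / R))))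

/-- **Identity (I), ψ-part** (sub-goal of the assembly; wave 3). Tested against `z sin(2πx₀)` /
`-(z' sin + z v₀ (2π cos))` and the dipole weight `|v|(1+|v|²)⁻⁴e^{-|v|²/R} v₀`, the hydrodynamic part gives
`-z [(2π²/3) + (π/10) λ Y₀ρ₀ s_ε] J'_R ∫cos(2πx₀)γ` (transport of `γ|v|²/2`: `∫ ϑ¹ v₀²|v|² = (2π/3)J'_R`;
collisional transfer: `∫_{S²} ν₀ sin(2πεν₀) dσ = s_ε`, `∫ ϑ¹ (v₀)₊⁴ = (π/5)J'_R`) plus uniformly bounded terms. -/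
def PsiOne : Prop :=
  ∀ (Y₀ ρ₀ ε lam C : ℝ), 0 < Y₀ → 0 < ρ₀ → 0 < ε → 2 * Real.pi * ε ≤ Real.pi / 2 → 0 < lam → 0 ≤ C →
  ∃ Bdd : ℝ, ∀ (cc : UnitAddTorus (Fin 3) → ℝ × EuclideanSpace ℝ (Fin 3) × ℝ) (κ : UnitAddTorus (Fin 3) → EuclideanSpace ℝ (Fin 3) → ℝ),
    Continuous cc → Continuous (Function.uncurry κ) → (∀ x, ‖cc x‖ ≤ C) →
    (∀ x y, dist (cc x) (cc y) ≤ C * dist x y) → (∀ x v, |κ x v| ≤ C * (1 + ‖v‖ ^ 2)) →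
    ∀ (Lψ : UnitAddTorus (Fin 3) → EuclideanSpace ℝ (Fin 3) → ℝ), (∀ x v, Lψ x v = lam * ∫ ω : Metric.sphere (0 : EuclideanSpace ℝ (Fin 3)) 1, (∫ w : EuclideanSpace ℝ (Fin 3),
        max (inner ℝ (v - w) (ω : EuclideanSpace ℝ (Fin 3))) 0 * Y₀ * (ρ₀ * globalMaxwellian w) *
          (((cc x).1 + inner ℝ (cc x).2.1 (v - inner ℝ (v - w) (ω : EuclideanSpace ℝ (Fin 3)) • (ω : EuclideanSpace ℝ (Fin 3))) + (cc x).2.2 * ‖(v - inner ℝ (v - w) (ω : EuclideanSpace ℝ (Fin 3)) • (ω : EuclideanSpace ℝ (Fin 3)))‖ ^ 2 / 2) +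
            ((cc (x + Torus.proj (ε • (ω : EuclideanSpace ℝ (Fin 3))))).1 + inner ℝ (cc (x + Torus.proj (ε • (ω : EuclideanSpace ℝ (Fin 3))))).2.1 (w + inner ℝ (v - w) (ω : EuclideanSpace ℝ (Fin 3)) • (ω : EuclideanSpace ℝ (Fin 3))) + (cc (x + Torus.proj (ε • (ω : EuclideanSpace ℝ (Fin 3))))).2.2 * ‖(w + inner ℝ (v - w) (ω : EuclideanSpace ℝ (Fin 3)) • (ω : EuclideanSpace ℝ (Fin 3)))‖ ^ 2 / 2) -
            ((cc x).1 + inner ℝ (cc x).2.1 v + (cc x).2.2 * ‖v‖ ^ 2 / 2) -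
            ((cc (x + Torus.proj (ε • (ω : EuclideanSpace ℝ (Fin 3))))).1 + inner ℝ (cc (x + Torus.proj (ε • (ω : EuclideanSpace ℝ (Fin 3))))).2.1 w + (cc (x + Torus.proj (ε • (ω : EuclideanSpace ℝ (Fin 3))))).2.2 * ‖w‖ ^ 2 / 2))) ∂sphereMeasure) →
    ∀ R : ℝ, 1 ≤ R → ∀ z z' : ℝ,
    Integrable (fun p : UnitAddTorus (Fin 3) × EuclideanSpace ℝ (Fin 3) => (Real.sqrt (‖p.2‖ ^ 2) * ((1 + ‖p.2‖ ^ 2) ^ 4)⁻¹ * Real.exp (-‖p.2‖ ^ 2 / R) * p.2 0) * ((-(z' * Torus.sinCoord 0 p.1 + z * (p.2 0 * ((2 * Real.pi) * Torus.cosCoord 0 p.1)))) * ((cc p.1).1 + inner ℝ (cc p.1).2.1 p.2 + (cc p.1).2.2 * ‖p.2‖ ^ 2 / 2) + (z * Torus.sinCoord 0 p.1) * Lψ p.1 p.2)) (volume.prod volume) ∧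
    |(∫ x : UnitAddTorus (Fin 3), ∫ v : EuclideanSpace ℝ (Fin 3), (Real.sqrt (‖v‖ ^ 2) * ((1 + ‖v‖ ^ 2) ^ 4)⁻¹ * Real.exp (-‖v‖ ^ 2 / R) * v 0) * ((-(z' * Torus.sinCoord 0 x + z * (v 0 * ((2 * Real.pi) * Torus.cosCoord 0 x)))) * ((cc x).1 + inner ℝ (cc x).2.1 v + (cc x).2.2 * ‖v‖ ^ 2 / 2) + (z * Torus.sinCoord 0 x) * Lψ x v)) -
        (-(z * ((2 * Real.pi ^ 2 / 3) + (Real.pi / 10) * lam * (Y₀ * ρ₀) * (∫ ν : Metric.sphere (0 : EuclideanSpace ℝ (Fin 3)) 1, (ν : EuclideanSpace ℝ (Fin 3)) 0 * Real.sin (2 * Real.pi * ε * (ν : EuclideanSpace ℝ (Fin 3)) 0) ∂sphereMeasure)) *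
          (∫ E in Set.Ioi (0 : ℝ), E ^ 3 * ((1 + E) ^ 4)⁻¹ * Real.exp (-E / R)) * (∫ x : UnitAddTorus (Fin 3), Torus.cosCoord 0 x * (cc x).2.2)))| ≤ (|z| + |z'|) * Bdd

/-- **Identity (I), transport of `κ`** (sub-goal of the assembly; wave 3): against the dipole weight the
`κ`-transport term is not pinned but small: `|·| ≤ |z'|·Bdd + |z| (2π/λ) C (m₂' + 2π J'_R)`. -/
def TransportKappaOne : Prop :=
  ∀ (Y₀ ρ₀ ε lam C : ℝ), 0 < Y₀ → 0 < ρ₀ → 0 < ε → 2 * Real.pi * ε ≤ Real.pi / 2 → 0 < lam → 0 ≤ C →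
  ∃ Bdd : ℝ, ∀ (cc : UnitAddTorus (Fin 3) → ℝ × EuclideanSpace ℝ (Fin 3) × ℝ) (κ : UnitAddTorus (Fin 3) → EuclideanSpace ℝ (Fin 3) → ℝ),
    Continuous cc → Continuous (Function.uncurry κ) → (∀ x, ‖cc x‖ ≤ C) →
    (∀ x y, dist (cc x) (cc y) ≤ C * dist x y) → (∀ x v, |κ x v| ≤ C * (1 + ‖v‖ ^ 2)) →
    ∀ R : ℝ, 1 ≤ R → ∀ z z' : ℝ,
    Integrable (fun p : UnitAddTorus (Fin 3) × EuclideanSpace ℝ (Fin 3) => (Real.sqrt (‖p.2‖ ^ 2) * ((1 + ‖p.2‖ ^ 2) ^ 4)⁻¹ * Real.exp (-‖p.2‖ ^ 2 / R) * p.2 0) * ((-(z' * Torus.sinCoord 0 p.1 + z * (p.2 0 * ((2 * Real.pi) * Torus.cosCoord 0 p.1)))) * (lam⁻¹ * κ p.1 p.2))) (volume.prod volume) ∧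
    |∫ x : UnitAddTorus (Fin 3), ∫ v : EuclideanSpace ℝ (Fin 3), (Real.sqrt (‖v‖ ^ 2) * ((1 + ‖v‖ ^ 2) ^ 4)⁻¹ * Real.exp (-‖v‖ ^ 2 / R) * v 0) * ((-(z' * Torus.sinCoord 0 x + z * (v 0 * ((2 * Real.pi) * Torus.cosCoord 0 x)))) * (lam⁻¹ * κ x v))| ≤
      (|z| + |z'|) * (Bdd + (4 * Real.pi ^ 2 * C / lam) * (∫ E in Set.Ioi (0 : ℝ), E ^ 3 * ((1 + E) ^ 4)⁻¹ * Real.exp (-E / R)))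

/-- **Identity (I), operator on `κ`** (sub-goal of the assembly; wave 3): against `z sin(2πx₀)` and the dipole
weight, `Lκ` gives `-z (π/5) Y₀ρ₀ 𝔨₀` (the `-1/5` contraction of the dipole sector, K1; the weight
`√E ϑ¹ = E(1+E)⁻⁴e^{-E/R}` differs from `ϑ` by an integrable amount) plus a uniformly bounded part plus the
un-pinned delocalisation terms `≤ |z| Y₀ρ₀ C 32π² (k + k²/2) J_R`, `k = 2πε`. -/
def OperatorKappaOne : Prop :=
  ∀ (Y₀ ρ₀ ε lam C : ℝ), 0 < Y₀ → 0 < ρ₀ → 0 < ε → 2 * Real.pi * ε ≤ Real.pi / 2 → 0 < lam → 0 ≤ C →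
  ∃ Bdd : ℝ, ∀ (cc : UnitAddTorus (Fin 3) → ℝ × EuclideanSpace ℝ (Fin 3) × ℝ) (κ : UnitAddTorus (Fin 3) → EuclideanSpace ℝ (Fin 3) → ℝ),
    Continuous cc → Continuous (Function.uncurry κ) → (∀ x, ‖cc x‖ ≤ C) →
    (∀ x y, dist (cc x) (cc y) ≤ C * dist x y) → (∀ x v, |κ x v| ≤ C * (1 + ‖v‖ ^ 2)) →
    ∀ (Lκ : UnitAddTorus (Fin 3) → EuclideanSpace ℝ (Fin 3) → ℝ), (∀ x v, Lκ x v = ∫ ω : Metric.sphere (0 : EuclideanSpace ℝ (Fin 3)) 1, (∫ w : EuclideanSpace ℝ (Fin 3),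
        max (inner ℝ (v - w) (ω : EuclideanSpace ℝ (Fin 3))) 0 * Y₀ * (ρ₀ * globalMaxwellian w) *
          (κ x (v - inner ℝ (v - w) (ω : EuclideanSpace ℝ (Fin 3)) • (ω : EuclideanSpace ℝ (Fin 3))) + κ (x + Torus.proj (ε • (ω : EuclideanSpace ℝ (Fin 3)))) (w + inner ℝ (v - w) (ω : EuclideanSpace ℝ (Fin 3)) • (ω : EuclideanSpace ℝ (Fin 3))) - κ x v - κ (x + Torus.proj (ε • (ω : EuclideanSpace ℝ (Fin 3)))) w)) ∂sphereMeasure) →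
    ∀ R : ℝ, 1 ≤ R → ∀ z z' : ℝ,
    Integrable (fun p : UnitAddTorus (Fin 3) × EuclideanSpace ℝ (Fin 3) => (Real.sqrt (‖p.2‖ ^ 2) * ((1 + ‖p.2‖ ^ 2) ^ 4)⁻¹ * Real.exp (-‖p.2‖ ^ 2 / R) * p.2 0) * ((z * Torus.sinCoord 0 p.1) * Lκ p.1 p.2)) (volume.prod volume) ∧
    |(∫ x : UnitAddTorus (Fin 3), ∫ v : EuclideanSpace ℝ (Fin 3), (Real.sqrt (‖v‖ ^ 2) * ((1 + ‖v‖ ^ 2) ^ 4)⁻¹ * Real.exp (-‖v‖ ^ 2 / R) * v 0) * ((z * Torus.sinCoord 0 x) * Lκ x v)) -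
        (-(z * (Real.pi / 5 * (Y₀ * ρ₀)) * (∫ x : UnitAddTorus (Fin 3), ∫ v : EuclideanSpace ℝ (Fin 3), ((1 + ‖v‖ ^ 2) ^ 3)⁻¹ * Real.exp (-‖v‖ ^ 2 / R) * v 0 * Torus.sinCoord 0 x * κ x v)))| ≤
      (|z| + |z'|) * (Bdd + Y₀ * ρ₀ * C * (32 * Real.pi ^ 2) *
        ((2 * Real.pi * ε) + (2 * Real.pi * ε) ^ 2 / 2) * (∫ E in Set.Ioi (0 : ℝ), E ^ 2 * (((1 + E) ^ 3)⁻¹ * Real.exp (-E / R))))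

/-- **Identity (0), integrated in time** (sub-goal of the assembly; wave 4). Summing the three
time-slice identities `PsiZero`, `TransportKappaZero`, `OperatorKappaZero` with `z = ζ(s)`, `z' = ζ'(s)`
and integrating over `s ∈ [0,1]` (the slices are bounded and jointly measurable in `s`): for `Φ = ψ + λ⁻¹κ`
and `Ł = Lψ + Lκ` on `[0,1]`,
`|∫₀¹∫∫ ϑ_R (−DZ₀ Φ + Z₀ Ł) − [(2π/λ + π²εY₀ρ₀) X_R − (π/8) λ Y₀ρ₀ μ_k J_R Γ]| ≤ Bdd + 2 Z_b Y₀ρ₀ C 32π²(k²/2 + k³/6) J_R`,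
`X_R = ∫₀¹ ζ 𝔨₀`, `Γ = ∫₀¹ ζ ∫cos(2πx₀)γ`, `k = 2πε`. -/
def IntegratedZero : Prop :=
  ∀ (Y₀ ρ₀ ε lam C Zb : ℝ), 0 < Y₀ → 0 < ρ₀ → 0 < ε → 2 * Real.pi * ε ≤ Real.pi / 2 → 0 < lam → 0 ≤ C → 0 ≤ Zb →
  ∃ Bdd : ℝ, ∀ (c : ℝ → UnitAddTorus (Fin 3) → ℝ × EuclideanSpace ℝ (Fin 3) × ℝ) (κ : ℝ → UnitAddTorus (Fin 3) → EuclideanSpace ℝ (Fin 3) → ℝ),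
    Continuous (Function.uncurry c) → Continuous (fun p : ℝ × UnitAddTorus (Fin 3) × EuclideanSpace ℝ (Fin 3) => κ p.1 p.2.1 p.2.2) →
    (∀ s x, ‖c s x‖ ≤ C) → (∀ s x y, dist (c s x) (c s y) ≤ C * dist x y) →
    (∀ s x v, |κ s x v| ≤ C * (1 + ‖v‖ ^ 2)) →
    ∀ (Φ Ł Lψ Lκ : ℝ → UnitAddTorus (Fin 3) → EuclideanSpace ℝ (Fin 3) → ℝ),
    (∀ s x v, Φ s x v = ((c s x).1 + inner ℝ (c s x).2.1 v + (c s x).2.2 * ‖v‖ ^ 2 / 2) + lam⁻¹ * κ s x v) →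
    (∀ s x v, Lψ s x v = lam * ∫ ω : Metric.sphere (0 : EuclideanSpace ℝ (Fin 3)) 1, (∫ w : EuclideanSpace ℝ (Fin 3),
        max (inner ℝ (v - w) (ω : EuclideanSpace ℝ (Fin 3))) 0 * Y₀ * (ρ₀ * globalMaxwellian w) *
          (((c s x).1 + inner ℝ (c s x).2.1 (v - inner ℝ (v - w) (ω : EuclideanSpace ℝ (Fin 3)) • (ω : EuclideanSpace ℝ (Fin 3))) + (c s x).2.2 * ‖(v - inner ℝ (v - w) (ω : EuclideanSpace ℝ (Fin 3)) • (ω : EuclideanSpace ℝ (Fin 3)))‖ ^ 2 / 2) +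
            ((c s (x + Torus.proj (ε • (ω : EuclideanSpace ℝ (Fin 3))))).1 + inner ℝ (c s (x + Torus.proj (ε • (ω : EuclideanSpace ℝ (Fin 3))))).2.1 (w + inner ℝ (v - w) (ω : EuclideanSpace ℝ (Fin 3)) • (ω : EuclideanSpace ℝ (Fin 3))) + (c s (x + Torus.proj (ε • (ω : EuclideanSpace ℝ (Fin 3))))).2.2 * ‖(w + inner ℝ (v - w) (ω : EuclideanSpace ℝ (Fin 3)) • (ω : EuclideanSpace ℝ (Fin 3)))‖ ^ 2 / 2) -
            ((c s x).1 + inner ℝ (c s x).2.1 v + (c s x).2.2 * ‖v‖ ^ 2 / 2) -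
            ((c s (x + Torus.proj (ε • (ω : EuclideanSpace ℝ (Fin 3))))).1 + inner ℝ (c s (x + Torus.proj (ε • (ω : EuclideanSpace ℝ (Fin 3))))).2.1 w + (c s (x + Torus.proj (ε • (ω : EuclideanSpace ℝ (Fin 3))))).2.2 * ‖w‖ ^ 2 / 2))) ∂sphereMeasure) →
    (∀ s x v, Lκ s x v = ∫ ω : Metric.sphere (0 : EuclideanSpace ℝ (Fin 3)) 1, (∫ w : EuclideanSpace ℝ (Fin 3),
        max (inner ℝ (v - w) (ω : EuclideanSpace ℝ (Fin 3))) 0 * Y₀ * (ρ₀ * globalMaxwellian w) *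
          (κ s x (v - inner ℝ (v - w) (ω : EuclideanSpace ℝ (Fin 3)) • (ω : EuclideanSpace ℝ (Fin 3))) + κ s (x + Torus.proj (ε • (ω : EuclideanSpace ℝ (Fin 3)))) (w + inner ℝ (v - w) (ω : EuclideanSpace ℝ (Fin 3)) • (ω : EuclideanSpace ℝ (Fin 3))) - κ s x v - κ s (x + Torus.proj (ε • (ω : EuclideanSpace ℝ (Fin 3)))) w)) ∂sphereMeasure) →
    (∀ s ∈ Set.Icc (0 : ℝ) 1, ∀ x v, Ł s x v = Lψ s x v + Lκ s x v) →
    ∀ (ζ : ℝ → ℝ), ContDiff ℝ 1 ζ → (∀ s, |ζ s| ≤ Zb ∧ |deriv ζ s| ≤ Zb) →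
    ∀ R : ℝ, 1 ≤ R →
    |(∫ s in Set.Icc (0 : ℝ) 1, ∫ x : UnitAddTorus (Fin 3), ∫ v : EuclideanSpace ℝ (Fin 3), ((1 + ‖v‖ ^ 2) ^ 3)⁻¹ * Real.exp (-‖v‖ ^ 2 / R) * (-(deriv ζ s * Torus.cosCoord 0 x + ζ s * (v 0 * (-(2 * Real.pi) * Torus.sinCoord 0 x))) * Φ s x v + ζ s * Torus.cosCoord 0 x * Ł s x v)) -
        ((2 * Real.pi / lam + Real.pi ^ 2 * ε * (Y₀ * ρ₀)) * (∫ s in Set.Icc (0 : ℝ) 1, ζ s * ∫ x : UnitAddTorus (Fin 3), ∫ v : EuclideanSpace ℝ (Fin 3), ((1 + ‖v‖ ^ 2) ^ 3)⁻¹ * Real.exp (-‖v‖ ^ 2 / R) * v 0 * Torus.sinCoord 0 x * κ s x v) -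
          (Real.pi / 8) * lam * (Y₀ * ρ₀) * (∫ ν : Metric.sphere (0 : EuclideanSpace ℝ (Fin 3)) 1, (1 - Real.cos (2 * Real.pi * ε * (ν : EuclideanSpace ℝ (Fin 3)) 0)) ∂sphereMeasure) * (∫ E in Set.Ioi (0 : ℝ), E ^ 2 * (((1 + E) ^ 3)⁻¹ * Real.exp (-E / R))) * (∫ s in Set.Icc (0 : ℝ) 1, ζ s * ∫ x : UnitAddTorus (Fin 3), Torus.cosCoord 0 x * (c s x).2.2))| ≤
      Bdd + 2 * Zb * (Y₀ * ρ₀ * C * (32 * Real.pi ^ 2) *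
        ((2 * Real.pi * ε) ^ 2 / 2 + (2 * Real.pi * ε) ^ 3 / 6)) * (∫ E in Set.Ioi (0 : ℝ), E ^ 2 * (((1 + E) ^ 3)⁻¹ * Real.exp (-E / R)))

/-- **Identity (I), integrated in time** (sub-goal of the assembly; wave 4). Summing `PsiOne`,
`TransportKappaOne`, `OperatorKappaOne` with `z = ζ(s)`, `z' = ζ'(s)` and integrating over `s ∈ [0,1]`:
`|∫₀¹∫∫ ϑ¹_R v₀ (−DZ₁ Φ + Z₁ Ł) + [(π/5) Y₀ρ₀ X_R + ((2π²/3) + (π/10) λ Y₀ρ₀ s_k) J'_R Γ]| ≤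
 Bdd + 2 Z_b [Y₀ρ₀ C 32π²(k + k²/2) J_R + (4π²C/λ) J'_R]`. -/
def IntegratedOne : Prop :=
  ∀ (Y₀ ρ₀ ε lam C Zb : ℝ), 0 < Y₀ → 0 < ρ₀ → 0 < ε → 2 * Real.pi * ε ≤ Real.pi / 2 → 0 < lam → 0 ≤ C → 0 ≤ Zb →
  ∃ Bdd : ℝ, ∀ (c : ℝ → UnitAddTorus (Fin 3) → ℝ × EuclideanSpace ℝ (Fin 3) × ℝ) (κ : ℝ → UnitAddTorus (Fin 3) → EuclideanSpace ℝ (Fin 3) → ℝ),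
    Continuous (Function.uncurry c) → Continuous (fun p : ℝ × UnitAddTorus (Fin 3) × EuclideanSpace ℝ (Fin 3) => κ p.1 p.2.1 p.2.2) →
    (∀ s x, ‖c s x‖ ≤ C) → (∀ s x y, dist (c s x) (c s y) ≤ C * dist x y) →
    (∀ s x v, |κ s x v| ≤ C * (1 + ‖v‖ ^ 2)) →
    ∀ (Φ Ł Lψ Lκ : ℝ → UnitAddTorus (Fin 3) → EuclideanSpace ℝ (Fin 3) → ℝ),
    (∀ s x v, Φ s x v = ((c s x).1 + inner ℝ (c s x).2.1 v + (c s x).2.2 * ‖v‖ ^ 2 / 2) + lam⁻¹ * κ s x v) →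
    (∀ s x v, Lψ s x v = lam * ∫ ω : Metric.sphere (0 : EuclideanSpace ℝ (Fin 3)) 1, (∫ w : EuclideanSpace ℝ (Fin 3),
        max (inner ℝ (v - w) (ω : EuclideanSpace ℝ (Fin 3))) 0 * Y₀ * (ρ₀ * globalMaxwellian w) *
          (((c s x).1 + inner ℝ (c s x).2.1 (v - inner ℝ (v - w) (ω : EuclideanSpace ℝ (Fin 3)) • (ω : EuclideanSpace ℝ (Fin 3))) + (c s x).2.2 * ‖(v - inner ℝ (v - w) (ω : EuclideanSpace ℝ (Fin 3)) • (ω : EuclideanSpace ℝ (Fin 3)))‖ ^ 2 / 2) +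
            ((c s (x + Torus.proj (ε • (ω : EuclideanSpace ℝ (Fin 3))))).1 + inner ℝ (c s (x + Torus.proj (ε • (ω : EuclideanSpace ℝ (Fin 3))))).2.1 (w + inner ℝ (v - w) (ω : EuclideanSpace ℝ (Fin 3)) • (ω : EuclideanSpace ℝ (Fin 3))) + (c s (x + Torus.proj (ε • (ω : EuclideanSpace ℝ (Fin 3))))).2.2 * ‖(w + inner ℝ (v - w) (ω : EuclideanSpace ℝ (Fin 3)) • (ω : EuclideanSpace ℝ (Fin 3)))‖ ^ 2 / 2) -
            ((c s x).1 + inner ℝ (c s x).2.1 v + (c s x).2.2 * ‖v‖ ^ 2 / 2) -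
            ((c s (x + Torus.proj (ε • (ω : EuclideanSpace ℝ (Fin 3))))).1 + inner ℝ (c s (x + Torus.proj (ε • (ω : EuclideanSpace ℝ (Fin 3))))).2.1 w + (c s (x + Torus.proj (ε • (ω : EuclideanSpace ℝ (Fin 3))))).2.2 * ‖w‖ ^ 2 / 2))) ∂sphereMeasure) →
    (∀ s x v, Lκ s x v = ∫ ω : Metric.sphere (0 : EuclideanSpace ℝ (Fin 3)) 1, (∫ w : EuclideanSpace ℝ (Fin 3),
        max (inner ℝ (v - w) (ω : EuclideanSpace ℝ (Fin 3))) 0 * Y₀ * (ρ₀ * globalMaxwellian w) *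
          (κ s x (v - inner ℝ (v - w) (ω : EuclideanSpace ℝ (Fin 3)) • (ω : EuclideanSpace ℝ (Fin 3))) + κ s (x + Torus.proj (ε • (ω : EuclideanSpace ℝ (Fin 3)))) (w + inner ℝ (v - w) (ω : EuclideanSpace ℝ (Fin 3)) • (ω : EuclideanSpace ℝ (Fin 3))) - κ s x v - κ s (x + Torus.proj (ε • (ω : EuclideanSpace ℝ (Fin 3)))) w)) ∂sphereMeasure) →
    (∀ s ∈ Set.Icc (0 : ℝ) 1, ∀ x v, Ł s x v = Lψ s x v + Lκ s x v) →
    ∀ (ζ : ℝ → ℝ), ContDiff ℝ 1 ζ → (∀ s, |ζ s| ≤ Zb ∧ |deriv ζ s| ≤ Zb) →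
    ∀ R : ℝ, 1 ≤ R →
    |(∫ s in Set.Icc (0 : ℝ) 1, ∫ x : UnitAddTorus (Fin 3), ∫ v : EuclideanSpace ℝ (Fin 3), (Real.sqrt (‖v‖ ^ 2) * ((1 + ‖v‖ ^ 2) ^ 4)⁻¹ * Real.exp (-‖v‖ ^ 2 / R) * v 0) * (-(deriv ζ s * Torus.sinCoord 0 x + ζ s * (v 0 * ((2 * Real.pi) * Torus.cosCoord 0 x))) * Φ s x v + ζ s * Torus.sinCoord 0 x * Ł s x v)) +
        ((Real.pi / 5 * (Y₀ * ρ₀)) * (∫ s in Set.Icc (0 : ℝ) 1, ζ s * ∫ x : UnitAddTorus (Fin 3), ∫ v : EuclideanSpace ℝ (Fin 3), ((1 + ‖v‖ ^ 2) ^ 3)⁻¹ * Real.exp (-‖v‖ ^ 2 / R) * v 0 * Torus.sinCoord 0 x * κ s x v) +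
          ((2 * Real.pi ^ 2 / 3) + (Real.pi / 10) * lam * (Y₀ * ρ₀) * (∫ ν : Metric.sphere (0 : EuclideanSpace ℝ (Fin 3)) 1, (ν : EuclideanSpace ℝ (Fin 3)) 0 * Real.sin (2 * Real.pi * ε * (ν : EuclideanSpace ℝ (Fin 3)) 0) ∂sphereMeasure)) * (∫ E in Set.Ioi (0 : ℝ), E ^ 3 * ((1 + E) ^ 4)⁻¹ * Real.exp (-E / R)) * (∫ s in Set.Icc (0 : ℝ) 1, ζ s * ∫ x : UnitAddTorus (Fin 3), Torus.cosCoord 0 x * (c s x).2.2))| ≤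
      Bdd + 2 * Zb * (Y₀ * ρ₀ * C * (32 * Real.pi ^ 2) * ((2 * Real.pi * ε) + (2 * Real.pi * ε) ^ 2 / 2) * (∫ E in Set.Ioi (0 : ℝ), E ^ 2 * (((1 + E) ^ 3)⁻¹ * Real.exp (-E / R))) +
        (4 * Real.pi ^ 2 * C / lam) * (∫ E in Set.Ioi (0 : ℝ), E ^ 3 * ((1 + E) ^ 4)⁻¹ * Real.exp (-E / R)))

/-- **The κ-dependent assembly (held by the lead; to be reshaped).** From the seven analytic stubs: the defect
inequality (iii) of an admissible family at the constant background, tested against `ζ(s)cos(2πx₀)Θ₀^R(v)` and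
`ζ(s)sin(2πx₀)Θ₁^R(v)`, yields two identities whose `κ`-dependent parts are either bounded in `R` (criticality K0,
exchange term, second-order delocalisation up to `ε²C J_R`) or the SAME first-moment functional of `κ` (transport
`2π/λ`, delocalisation `π²εA` by K2, and `-πA/5` by K1), while the `γ`-dependent parts are `J_R ∫ζΓ_c` times
positive constants (second spatial difference `-2πλAμ_ε(π/4)`, transport `2π²/3`, collisional transfer
`2πλAs_ε(π/5)`); Step A pins `∫ζΓ_c ≥ 1/8`; eliminating the functional gives `J_R · d_N ≤ B_N + u_N(C) J_R` with
`u_N(C) < d_N` for `N` large, contradicting `J_R ≥ log R / 25`. -/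
def Assembly : Prop :=
  HalfGaussian → SphereCalculus → DualitySlice → KernelCritical → KernelDipole → KernelDeloc → Flight →
    RadialSymmetry → KernelBridge → KappaOperator → PsiZero → TransportKappaZero → OperatorKappaZero →
    PsiOne → TransportKappaOne → OperatorKappaOne → IntegratedZero → IntegratedOne → ¬ AdjointEnskogTestFamilyR

/-! ### Registered stubs (`sorry` only here) -/

/-- LANDED (wave 1, p166447): half-Gaussian moments and loss-rate asymptotics — the skeleton's
`HalfGaussian` is literally the type of `Theorems.EnskogAdjointDuality.stub_halfGaussian`. -/
theorem stub_halfGaussian : HalfGaussian :=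
  Summit.AtomisticToContinuum.HydrodynamicLimit.Theorems.EnskogAdjointDuality.stub_halfGaussian

/-- STUB (S/M; wave 1): Funk–Hecke degree one, delocalisation constants, radial moments. -/
theorem stub_sphereCalculus : SphereCalculus := by
  sorry

/-- STUB (M/L; wave 1): the per-direction pre/post-collisional duality with the explicit swap kernels. -/
theorem stub_dualitySlice : DualitySlice := by
  sorry

/-- STUB (L; wave 1): criticality of the isotropic sector (uniform `L¹((1+E)√E dE)` bound of the dual kernel). -/
theorem stub_kernelCritical : KernelCritical := by
  sorry

/-- STUB (L; wave 1): the `-1/5` contraction of the dipole sector. -/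
theorem stub_kernelDipole : KernelDipole := by
  sorry

/-- STUB (M/L; wave 1): the `π/2` first moment of the per-direction kernel. -/
theorem stub_kernelDeloc : KernelDeloc := by
  sorry

/-- LANDED (wave 1, p166813): integration by parts along free flights, tested — the skeleton's `Flight`
is literally the type of `Theorems.EnskogAdjointDuality.stub_flight`. -/
theorem stub_flight : Flight :=
  Summit.AtomisticToContinuum.HydrodynamicLimit.Theorems.EnskogAdjointDuality.stub_flight

/-- LANDED (wave 2, p167367): radial symmetry integrals on `ℝ³`. -/
theorem stub_radialSymmetry : RadialSymmetry :=
  Summit.AtomisticToContinuum.HydrodynamicLimit.Theorems.EnskogAdjointDuality.stub_radialSymmetry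

/-- STUB (M; wave 2): sphere integrals of the explicit kernels and polar reductions. -/
theorem stub_kernelBridge : KernelBridge := by
  sorry

/-- STUB (M; wave 2): the four-piece split of the test-side operator on `κ`. -/
theorem stub_kappaOperator : KappaOperator := by
  sorry

/-- STUB (L; wave 3): PsiZero. -/
theorem stub_psiZero : PsiZero := by
  sorry

/-- STUB (L; wave 3): TransportKappaZero. -/
theorem stub_transportKappaZero : TransportKappaZero := by
  sorry

/-- STUB (L; wave 3): OperatorKappaZero. -/
theorem stub_operatorKappaZero : OperatorKappaZero := by
  sorry

/-- STUB (L; wave 3): PsiOne. -/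
theorem stub_psiOne : PsiOne := by
  sorry

/-- STUB (L; wave 3): TransportKappaOne. -/
theorem stub_transportKappaOne : TransportKappaOne := by
  sorry

/-- STUB (L; wave 3): OperatorKappaOne. -/
theorem stub_operatorKappaOne : OperatorKappaOne := by
  sorry

/-- STUB (L; wave 4): IntegratedZero. -/
theorem stub_integratedZero : IntegratedZero := by
  sorry

/-- STUB (L; wave 4): IntegratedOne. -/
theorem stub_integratedOne : IntegratedOne := by
  sorry

/-- STUB (XL; LEAD): the κ-dependent assembly — flight identity, ψ-operator structure, involution, Step A, the two
tested identities, final bookkeeping. -/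
theorem stub_assembly : Assembly := by
  sorry

/-! ### Name-keyed aliases of the stub statements -/
namespace Registered

/-- Alias keyed by the registered stub name. -/
abbrev stub_halfGaussian : Prop := HalfGaussian
/-- Alias keyed by the registered stub name. -/
abbrev stub_sphereCalculus : Prop := SphereCalculus
/-- Alias keyed by the registered stub name. -/
abbrev stub_dualitySlice : Prop := DualitySlice
/-- Alias keyed by the registered stub name. -/
abbrev stub_kernelCritical : Prop := KernelCritical
/-- Alias keyed by the registered stub name. -/
abbrev stub_kernelDipole : Prop := KernelDipole
/-- Alias keyed by the registered stub name. -/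
abbrev stub_kernelDeloc : Prop := KernelDeloc
/-- Alias keyed by the registered stub name. -/
abbrev stub_flight : Prop := Flight
/-- Alias keyed by the registered stub name. -/
abbrev stub_radialSymmetry : Prop := RadialSymmetry
/-- Alias keyed by the registered stub name. -/
abbrev stub_kernelBridge : Prop := KernelBridge
/-- Alias keyed by the registered stub name. -/
abbrev stub_kappaOperator : Prop := KappaOperator
/-- Alias keyed by the registered stub name. -/
abbrev stub_psiZero : Prop := PsiZero
/-- Alias keyed by the registered stub name. -/
abbrev stub_transportKappaZero : Prop := TransportKappaZero
/-- Alias keyed by the registered stub name. -/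
abbrev stub_operatorKappaZero : Prop := OperatorKappaZero
/-- Alias keyed by the registered stub name. -/
abbrev stub_psiOne : Prop := PsiOne
/-- Alias keyed by the registered stub name. -/
abbrev stub_transportKappaOne : Prop := TransportKappaOne
/-- Alias keyed by the registered stub name. -/
abbrev stub_operatorKappaOne : Prop := OperatorKappaOne
/-- Alias keyed by the registered stub name. -/
abbrev stub_integratedZero : Prop := IntegratedZero
/-- Alias keyed by the registered stub name. -/
abbrev stub_integratedOne : Prop := IntegratedOne
/-- Alias keyed by the registered stub name. -/
abbrev stub_assembly : Prop := Assembly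

end Registered

/-! ### Composition (PROVED): the stubs refute the crux BY NAME -/

/-- **The line refutes the crux BY NAME** from the registered stubs (no `sorry` outside them). -/
theorem not_AdjointEnskogTestFamilyR_of (h₁ : Registered.stub_halfGaussian) (h₂ : Registered.stub_sphereCalculus)
    (h₃ : Registered.stub_dualitySlice) (h₄ : Registered.stub_kernelCritical) (h₅ : Registered.stub_kernelDipole)
    (h₆ : Registered.stub_kernelDeloc) (h₇ : Registered.stub_flight) (h₈ : Registered.stub_radialSymmetry)
    (h₉ : Registered.stub_kernelBridge) (h₁₀ : Registered.stub_kappaOperator) (h₁₁ : Registered.stub_psiZero)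
    (h₁₂ : Registered.stub_transportKappaZero) (h₁₃ : Registered.stub_operatorKappaZero)
    (h₁₄ : Registered.stub_psiOne) (h₁₅ : Registered.stub_transportKappaOne)
    (h₁₆ : Registered.stub_operatorKappaOne) (h₁₇ : Registered.stub_integratedZero)
    (h₁₈ : Registered.stub_integratedOne) (hA : Registered.stub_assembly) :
    ¬ AdjointEnskogTestFamilyR :=
  hA h₁ h₂ h₃ h₄ h₅ h₆ h₇ h₈ h₉ h₁₀ h₁₁ h₁₂ h₁₃ h₁₄ h₁₅ h₁₆ h₁₇ h₁₈

/-- The refutation of K2R, modulo the registered stubs. -/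
theorem not_AdjointEnskogTestFamilyR : ¬ AdjointEnskogTestFamilyR :=
  not_AdjointEnskogTestFamilyR_of stub_halfGaussian stub_sphereCalculus stub_dualitySlice stub_kernelCritical
    stub_kernelDipole stub_kernelDeloc stub_flight stub_radialSymmetry stub_kernelBridge stub_kappaOperator
    stub_psiZero stub_transportKappaZero stub_operatorKappaZero stub_psiOne stub_transportKappaOne
    stub_operatorKappaOne stub_integratedZero stub_integratedOne stub_assembly

/-- The NEGATION of the crux, as a named proposition (the target of this refutation skeleton). -/
abbrev NotAdjointEnskogTestFamilyR : Prop := ¬ AdjointEnskogTestFamilyR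

/-- Skeleton-keyed form: the line proves `NotAdjointEnskogTestFamilyR` (= `¬ AdjointEnskogTestFamilyR`). -/
theorem NotAdjointEnskogTestFamilyR_proof : NotAdjointEnskogTestFamilyR := not_AdjointEnskogTestFamilyR

end Summit.AtomisticToContinuum.HydrodynamicLimit.Cruxes.AdjointEnskogTestFamilyR.Refutation
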